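import Summits.HubbardSuperconductivity.HubbardSuperconductivity.Theses.SignStructure
import Summits.HubbardSuperconductivity.HubbardSuperconductivity.Theorems.SignStructureShadowTransfer
import Literature.MathematicalPhysics.QuantumLattice.PairCorrelationsProofs
import Literature.MathematicalPhysics.QuantumLattice.HubbardWave0Proofs

/-!
# Census evidence (crux-strategist `cstrat-stmt-HubbardSuperconductivity-2136`):
# the membership piece `JastrowSlaterShadow` is implied by the lim-form of `Target` with NO physics

Route `SignStructure`, deciding crux `Target` (stmt-2136) — the only recorded derivation of `Target`
inside the route is `ShadowTransfer : JastrowSlaterNoDWaveLRO → JastrowSlaterShadow → Target`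
(proved, `shadowTransfer_proof`). This file checks criterion (c) of the BC2-redirect test IN
SUBSTANCE for the piece `JastrowSlaterShadow` (stmt-14442):

* `TargetLim` — the lim-form of `Target` (some admissible sequence has the normalised d-wave
  pair functional `F_d(ψ_{L+1}) → 0` along ALL sides);
* `target_of_targetLim : TargetLim → Target` (even-side bookkeeping, as in `ShadowTransfer`);
* `jastrowSlaterShadow_of_targetLim_junk : TargetLim → JastrowSlaterShadow` — witness: the
  Jastrow–Slater datum `r = 0, g ≡ 1, N' ≡ 1, φ ≡ 0`, whose state `χ` is the ZERO VECTOR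
  (`slater 0 = 0`), so `F_d(χ) = 0/0 = 0` by the division convention (a vacuity artefact of the
  typing of stmt-14442: the class quantifies over ALL orbitals, including `φ = 0`);
* `jastrowSlaterShadow_of_targetLim_vacuum : TargetLim → JastrowSlaterShadow` — witness: the
  EMPTY determinant `N' ≡ 0` (a legitimate, non-zero, normalisable member of the class: the Fock
  vacuum reweighted), d-inert because `Δ_d |∅⟩ = 0`; so the collapse survives the obvious repair
  "require χ ≠ 0";
* `targetLim_of_shadow_of_noLRO : JastrowSlaterNoDWaveLRO → JastrowSlaterShadow → TargetLim` —
  hence, GIVEN the other piece, `JastrowSlaterShadow ↔ TargetLim` (`jastrowSlaterShadow_iff_targetLim`).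

Conclusion: the piece `JastrowSlaterShadow` is sandwiched `TargetLim → JastrowSlaterShadow →
(JastrowSlaterNoDWaveLRO → TargetLim)`; its content beyond the lim-form of the very statement it is
meant to reduce is nil. The split {JastrowSlaterNoDWaveLRO, JastrowSlaterShadow} ⊢ Target therefore
fails BC2-redirect (c) in substance (and (d): no plan for the shadow), although the MECHANICAL
probes `JastrowSlaterShadow → Target` / `→ ¬S` by `exact? | simpa | aesop` fail (see bc/*_probe.lean).
-/

set_option linter.dupNamespace false
set_option linter.unusedSectionVars false

namespace Summit.HubbardSuperconductivity.HubbardSuperconductivity.Cruxes.Target.Census2136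

open Matrix Filter
open Literature.MathematicalPhysics.QuantumLattice Literature.Probability.LatticeModels
open Summit.HubbardSuperconductivity.HubbardSuperconductivity.Theses.SignStructure
open Summit.HubbardSuperconductivity.HubbardSuperconductivity.Theorems

/-- The lim-form of `Target`: for every `U > 0`, `δ ∈ (0,1/2)` some admissible sequence (sector
ground states at even sides, free at odd sides) has normalised d-wave pair functional
`F_d(ψ_{L+1}) = re ⟨ψ, Δ_d†Δ_d ψ⟩ / (re ⟨ψ,ψ⟩ (L+1)⁴) → 0` along all sides. [folklore] -/
def TargetLim : Prop :=
  ∀ U : ℝ, 0 < U → ∀ δ ∈ Set.Ioo (0:ℝ) (1/2), ∃ (N : ℕ → ℕ)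
    (ψ : ∀ L, Fock (Orb (FermionTorus 2 L))),
    (∀ L, Even L → N L = 2 * ⌊(1 - δ) * (L : ℝ) ^ 2 / 2⌋₊ ∧ star (ψ L) ⬝ᵥ ψ L = 1 ∧
        IsGroundStateInSector (hubbardTorus 2 L 1 U) (N L) 0 (ψ L)) ∧
      Tendsto (fun L : ℕ =>
        (expect ((pairField dWaveFormFactor (L + 1))ᴴ * pairField dWaveFormFactor (L + 1))
            (ψ (L + 1))).re /
          ((star (ψ (L + 1)) ⬝ᵥ ψ (L + 1)).re * ((L + 1 : ℕ) : ℝ) ^ 4)) atTop (nhds 0)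

/-- `TargetLim → Target` (even-side bookkeeping only). [folklore] -/
theorem target_of_targetLim (h : TargetLim) : Target := by
  intro U hU δ hδ
  obtain ⟨N, ψ, hadm, hF⟩ := h U hU δ hδ
  refine ⟨N, ψ, hadm, not_hasLongRangeOrder_of_tendsto_zero ψ (fun j => ?_) hF⟩
  exact (hadm (2 * (j + 1)) (even_two_mul (j + 1))).2.1

section Junk

variable {ι : Type*} [LinearOrder ι] [Fintype ι]

/-- JUNK WITNESS. With `N ≠ 0` orbitals all equal to `0`, the first-quantised amplitude
`o ↦ ∏_k 0` vanishes, the "Slater determinant" is the zero vector, every reweighting of it is the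
zero vector, and the normalised functional `re⟨χ, M χ⟩ / (re⟨χ,χ⟩ · c)` is `0 / 0 = 0`. [folklore] -/
theorem shadowF_junk (M : Matrix (Finset ι) (Finset ι) ℂ) (w : Finset ι → ℂ) {N : ℕ} (hN : N ≠ 0)
    (c : ℝ) :
    (expect M (fun s => w s * FirstQuant.slater (fun _ : Fin N → ι => ∏ _k : Fin N, (0:ℂ)) s)).re /
      ((star (fun s => w s * FirstQuant.slater (fun _ : Fin N → ι => ∏ _k : Fin N, (0:ℂ)) s) ⬝ᵥ
          (fun s => w s * FirstQuant.slater (fun _ : Fin N → ι => ∏ _k : Fin N, (0:ℂ)) s)).re * c)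
      = 0 := by
  have h0 : (fun _ : Fin N → ι => ∏ _k : Fin N, (0:ℂ)) = 0 := by
    funext o
    simp [Finset.prod_const, hN]
  have hχ : (fun s => w s * FirstQuant.slater (fun _ : Fin N → ι => ∏ _k : Fin N, (0:ℂ)) s) = 0 := by
    funext s
    rw [h0, FirstQuant.slater_zero]
    simp
  rw [hχ]
  simp [expect]

end Junk

section Vacuum

variable {ι : Type*} [LinearOrder ι] [Fintype ι]

/-- The Slater vector of ZERO orbitals is a multiple of the Fock vacuum. [folklore] -/
theorem slater_fin_zero (φ : (Fin 0 → ι) → ℂ) (o₀ : Fin 0 → ι) :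
    FirstQuant.slater φ = φ o₀ • (vacuum : Fock ι) := by
  rw [FirstQuant.slater, Fintype.sum_subsingleton _ o₀]
  simp

/-- A diagonal reweighting of (a multiple of) the vacuum is a multiple of the vacuum. [folklore] -/
theorem weight_mul_smul_vacuum (w : Finset ι → ℂ) (a : ℂ) :
    (fun s => w s * (a • (vacuum : Fock ι)) s) = (w ∅ * a) • (vacuum : Fock ι) := by
  funext s
  by_cases hs : s = ∅
  · subst hs
    simp [vacuum]
  · simp [vacuum, hs]

/-- `P_x |∅⟩ = 0`: every local pair operator annihilates the vacuum. [folklore] -/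
theorem localPair_mulVec_vacuum (g : Site 2 → ℝ) (L : ℕ) [NeZero L] (x : TorusSite 2 L) :
    localPair g L x *ᵥ (vacuum : Fock (Orb (FermionTorus 2 L))) = 0 := by
  unfold localPair
  rw [Matrix.sum_mulVec]
  refine Finset.sum_eq_zero fun e _ => ?_
  rw [Matrix.smul_mulVec, Matrix.sub_mulVec, ← Matrix.mulVec_mulVec, ← Matrix.mulVec_mulVec,
    annihilation_mulVec_vacuum_holds, annihilation_mulVec_vacuum_holds, Matrix.mulVec_zero,
    Matrix.mulVec_zero, sub_self, smul_zero]

/-- `Δ_g |∅⟩ = 0`. [folklore] -/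
theorem pairField_mulVec_vacuum (g : Site 2 → ℝ) (L : ℕ) [NeZero L] :
    pairField g L *ᵥ (vacuum : Fock (Orb (FermionTorus 2 L))) = 0 := by
  unfold pairField
  rw [Matrix.sum_mulVec]
  exact Finset.sum_eq_zero fun x _ => localPair_mulVec_vacuum g L x

/-- VACUUM WITNESS. For ZERO orbitals (`N' = 0`, the empty determinant) the reweighted Slater vector
is a (generally non-zero) multiple of the vacuum, which `Δ_g` annihilates; so the normalised pair
functional vanishes identically, whatever the weight. [folklore] -/
theorem shadowF_vacuum (g : Site 2 → ℝ) (L : ℕ) [NeZero L]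
    (w : Finset (Orb (FermionTorus 2 L)) → ℂ) (φ : (Fin 0 → Orb (FermionTorus 2 L)) → ℂ) (c : ℝ) :
    (expect ((pairField g L)ᴴ * pairField g L) (fun s => w s * FirstQuant.slater φ s)).re /
      ((star (fun s => w s * FirstQuant.slater φ s) ⬝ᵥ (fun s => w s * FirstQuant.slater φ s)).re * c)
      = 0 := by
  have hχ : (fun s => w s * FirstQuant.slater φ s) =
      (w ∅ * φ (fun i => i.elim0)) • (vacuum : Fock _) := by
    rw [slater_fin_zero φ (fun i => i.elim0)]
    exact weight_mul_smul_vacuum w (φ (fun i => i.elim0))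
  rw [hχ]
  have h0 : expect ((pairField g L)ᴴ * pairField g L)
      ((w ∅ * φ (fun i => i.elim0)) • vacuum) = 0 := by
    simp only [expect]
    rw [← Matrix.mulVec_mulVec, Matrix.mulVec_smul, pairField_mulVec_vacuum, smul_zero,
      Matrix.mulVec_zero, dotProduct_zero]
  rw [h0, Complex.zero_re, zero_div]

end Vacuum

/-- **Collapse, junk form.** `TargetLim → JastrowSlaterShadow` with the Jastrow–Slater datum
`r = 0, g ≡ 1, N' ≡ 1, φ ≡ 0` (zero vector). [folklore] -/
theorem jastrowSlaterShadow_of_targetLim_junk (h : TargetLim) : JastrowSlaterShadow := by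
  intro U hU δ hδ
  obtain ⟨N, ψ, hadm, hF⟩ := h U hU δ hδ
  refine ⟨N, ψ, hadm, 0, fun _ => 1, fun _ => one_pos, fun _ => 1, fun _ _ _ => 0, ?_⟩
  convert hF using 1
  funext L
  rw [sub_eq_self]
  dsimp only
  exact shadowF_junk _ _ one_ne_zero _

/-- **Collapse, vacuum form.** `TargetLim → JastrowSlaterShadow` with the datum
`r = 0, g ≡ 1, N' ≡ 0` (empty determinant = reweighted Fock vacuum, non-zero). [folklore] -/
theorem jastrowSlaterShadow_of_targetLim_vacuum (h : TargetLim) : JastrowSlaterShadow := by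
  intro U hU δ hδ
  obtain ⟨N, ψ, hadm, hF⟩ := h U hU δ hδ
  refine ⟨N, ψ, hadm, 0, fun _ => 1, fun _ => one_pos, fun _ => 0, fun _ _ _ => 0, ?_⟩
  convert hF using 1
  funext L
  rw [sub_eq_self]
  dsimp only
  exact shadowF_vacuum dWaveFormFactor (L + 1) _ _ _

/-- Upper side of the sandwich: given the exclusion crux, the shadow gives the lim-form (this is
the analytic core of `shadowTransfer_proof`). [folklore] -/
theorem targetLim_of_shadow_of_noLRO (hNo : JastrowSlaterNoDWaveLRO) (hSh : JastrowSlaterShadow) :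
    TargetLim := by
  intro U hU δ hδ
  obtain ⟨N, ψ, hadm, r, g, hg, N', φ, hT⟩ := hSh U hU δ hδ
  exact ⟨N, ψ, hadm, tendsto_zero_of_sub_of_tendsto_zero hT (hNo r g hg N' φ)⟩

/-- **The membership piece is the lim-form of the target, modulo the other piece.** [folklore] -/
theorem jastrowSlaterShadow_iff_targetLim (hNo : JastrowSlaterNoDWaveLRO) :
    JastrowSlaterShadow ↔ TargetLim :=
  ⟨targetLim_of_shadow_of_noLRO hNo, jastrowSlaterShadow_of_targetLim_vacuum⟩

/-- And unconditionally the piece already carries the target, given the exclusion crux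
(= `ShadowTransfer`, restated for the record). [folklore] -/
theorem target_of_pieces (hNo : JastrowSlaterNoDWaveLRO) (hSh : JastrowSlaterShadow) : Target :=
  target_of_targetLim (targetLim_of_shadow_of_noLRO hNo hSh)

end Summit.HubbardSuperconductivity.HubbardSuperconductivity.Cruxes.Target.Census2136
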